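import Summits.BirchSwinnertonDyer.BirchSwinnertonDyer.Theorems.GenusKolyvaginAtTwoK1PosSuHalvesValuationLedger
import Summits.BirchSwinnertonDyer.BirchSwinnertonDyer.Theorems.GenusKolyvaginAtTwoKFourWitnessDefectCurrency
import HarnessLib

/-!
# Route `GenusKolyvaginAtTwo`, crux K₁⁺ `K1Pos` (stmt-BirchSwinnertonDyer-31468): «TWO OUT OF THREE» among {depth zero `M₀ = 0`, `BSD₂(E)`,
# `BSD₂(E^(d_K))`} at every K₁⁺ frame — NO cut, NO Q2, modulo the four PRINT items only

LEAD seat `bsd-line-gk2-p1` g26 (cell `bsd-f1-sign2`), `--supports stmt-BirchSwinnertonDyer-31468`; sequel of `…K1PosSuHalvesValuationLedger` (p782123: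
the exact ledger `2·M₀ = ord₂ #Ш_an(E) + ord₂ #Ш_an(Wd)` on K₁⁺ frames) and `…KFourWitnessDefectCurrency` (p782353, the K₄ analogue on the cut).
THEOREMS ONLY (no definition, no named fact, no `sorry`); standard axioms.  **BSD is NOT proved by this file; K1Pos / U₂ / WALL row 1 are NOT proved;
no item is closed.**  CONDITIONAL on the route's four PRINT items (`GrossZagierAllLevels`, `MultPublishedInputsAtTwo`, `EntireLFunctionRat`,
`MilneAnyModel`), displayed as binders.

WHAT.  On a K₁⁺ frame (habitat curve `E` with `Δ > 0` and `#Sel₂(E) = 1`; an `(H2)` field `K`; odd-Manin `Dt`; `d₁` with `2^(M₀) ∥ P(1)`, ANY `M₀`;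
the `Sel₂`-minimal rank-one twin `Wd ≅ E^(d_K)` with `ord₂ C(Wd) = 0`) all three algebraic `Ш[2^∞]` vanish, so `BSD₂(E) ⟺ ord₂ #Ш_an(E) = 0`,
`BSD₂(Wd) ⟺ ord₂ #Ш_an(Wd) = 0`, and the ledger reads `2·M₀ = ord₂ #Ш_an(E) + ord₂ #Ш_an(Wd)`.  Hence:
* §1 `kOnePos_depth_eq_zero_iff_defects_cancel` — **`M₀ = 0 ⟺ ord₂ #Ш_an(E) + ord₂ #Ш_an(Wd) = 0`**;
* §2 `bsdp_twin_of_depth_zero_of_bsdp_kOnePos` — **`BSD₂(E)` ∧ `M₀ = 0` ⟹ `BSD₂(Wd)`** (NEW LEG: on the `#Sel₂(E) = 1` cells the route item U₂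
  for the cell's own twin follows from WALL row 1 at `E` and Kolyvagin `2`-primitivity of `y_K`);
* §3 `bsdp_of_depth_zero_of_bsdp_twin_kOnePos` — `BSD₂(Wd)` ∧ `M₀ = 0` ⟹ `BSD₂(E)` (the `closes` direction, here in three lines from the ledger);
* §4 `depth_eq_zero_of_bsdp_pair_kOnePos` — `BSD₂(E)` ∧ `BSD₂(Wd)` ⟹ `M₀ = 0` (= Lossless §4 with the leaf replaced by the pair).
READING (census, not progress): the pen's LINES 33/35 read K₁ ⟸ WALL row 1 + U₂ + PRINT; this file adds the two other legs, so on the depth-zero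
cells the three open inputs {K₁ at the frame, WALL row 1 at `E`, U₂ at `E^(d_K)`} are pairwise equivalent modulo the third and PRINT — without Q2
and without a multiplicative prime.

References: [GrossZagier1986] V §2 (2.2); [Milne1972ArithmeticAV] §1 Thm. 1; [Kramer1981] Thm. 1; [Miller2011LMS] Def. 1.1; [SilvermanAEC2009] Thm. X.4.2.
-/

set_option autoImplicit false
set_option linter.dupNamespace false -- `Summit.<P>.<Sub>` repeats `BirchSwinnertonDyer` (D-0017)

noncomputable section

open scoped Classical

namespace Summit.BirchSwinnertonDyer.BirchSwinnertonDyer.Theorems.GenusExact.ValuationLedger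

open WeierstrassCurve NumberField Literature.NumberTheory.EllipticCurves Literature.NumberTheory.EllipticCurves.ModularForms
  Literature.NumberTheory.GaloisRepresentations
  Summit.BirchSwinnertonDyer.BirchSwinnertonDyer.Theses.GenusKolyvaginAtTwo
  Summit.BirchSwinnertonDyer.BirchSwinnertonDyer.Theorems.GenusSupplyNarrow.Lossless

/-! ## §1 Depth zero is the cancellation of the two BSD₂-defects -/

/-- **`M₀ = 0 ⟺ ord₂ #Ш_an(E) + ord₂ #Ш_an(Wd) = 0`** at every K₁⁺ frame (LINE 31 G′ binders, any `M₀`), for the rational values `#Ш_an(E) = qW`,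
`#Ш_an(Wd) = qd` — the exact ledger `k1Pos_valuationLedger_eq`.  CONDITIONAL on the four print items; nothing about BSD is proved.
[cite: GrossZagier1986, V §2 (2.2)] [cite: Milne1972ArithmeticAV, §1 Thm. 1] [cite: Miller2011LMS, Def. 1.1] -/
theorem kOnePos_depth_eq_zero_iff_defects_cancel (hGZ : GrossZagierAllLevels) (hGZK : MultPublishedInputsAtTwo) (hL : EntireLFunctionRat)
    (hMi : MilneAnyModel)
    (W : WeierstrassCurve ℚ) [W.IsElliptic] [W.IsGloballyMinimal] [NeZero (W.conductorNorm ℤ)]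
    (hcm : ¬ W.HasCM) (hr0 : W.analyticRank = 0) (hρ : ∀ n : ℕ, 0 < n → W.HasSurjectiveModNGaloisRep ((2 : ℤ) ^ n))
    (hT : Odd W.tamagawaProduct) (hpos : 0 < W.Δ) (hSel1 : Nat.card (W.selmerGroup 2) = 1)
    (K : Type) [Field K] [NumberField K] (hIQ : IsImaginaryQuadratic K) (hodd : Odd (NumberField.discr K))
    (h3 : NumberField.discr K ≠ -3) (hHe : SatisfiesHeegnerHypothesis (W.conductorNorm ℤ) K)
    (hsq1 : ¬ IsSquare ((NumberField.discr K : ℚ) * -|W.Δ|)) (hsq2 : ¬ IsSquare ((NumberField.discr K : ℚ) * (-(2 * |W.Δ|))))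
    (Dt : ModularParametrizationData W (W.conductorNorm ℤ))
    (hopt : ∀ z ∈ Dt.L.lattice, ∃ w ∈ periodLattice Dt.f, z = (Dt.c : ℂ) * w) (hc : Odd Dt.c)
    (β : ℤ) (ι : K →+* ℂ) (d₁ : KolyvaginHeegnerData Dt β ι 1) (hy : ¬ IsOfFinAddOrder d₁.derivedPoint)
    (M₀ : ℕ) (hdiv : ∃ Q : (W.baseChange (ringClassField K ι 1)).toAffine.Point, ((2 ^ M₀ : ℕ) : ℤ) • Q = d₁.derivedPoint)
    (hndiv : ¬ ∃ Q : (W.baseChange (ringClassField K ι 1)).toAffine.Point, ((2 ^ (M₀ + 1) : ℕ) : ℤ) • Q = d₁.derivedPoint)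
    (Wd : WeierstrassCurve ℚ) [Wd.IsElliptic] [Wd.IsGloballyMinimal]
    (hWd : ∃ C : VariableChange ℚ, C • W.quadraticTwist (NumberField.discr K : ℚ) = Wd)
    (hrd : Wd.analyticRank = 1) (hSel : Nat.card (Wd.selmerGroup 2) = 2) (hDEF : padicValNat 2 Wd.tamagawaProduct = 0)
    {qW qd : ℚ} (hqW : shaAn W = (qW : ℂ)) (hqd : shaAn Wd = (qd : ℂ)) :
    M₀ = 0 ↔ padicValRat 2 qW + padicValRat 2 qd = 0 := by
  have h := k1Pos_valuationLedger_eq hGZ hGZK hL hMi W hcm hr0 hρ hT hpos hSel1 K hIQ hodd h3 hHe hsq1 hsq2 Dt hopt hc β ι d₁ hy M₀ hdiv hndiv Wd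
    hWd hrd hSel hDEF qW qd hqW hqd
  constructor
  · intro h0
    rw [h0, Nat.cast_zero, mul_zero] at h
    exact h.symm
  · intro h0
    have : (M₀ : ℤ) = 0 := by linarith
    exact_mod_cast this

/-! ## §2 The new leg: `BSD₂(E)` + depth zero ⟹ `BSD₂(E^(d_K))` -/

/-- **`BSD₂(E)` ∧ `M₀ = 0` ⟹ `BSD₂(Wd)`** at every K₁⁺ frame, modulo PRINT (no Q2, no multiplicative prime): `BSD₂(E)` and `Ш(E/ℚ)[2^∞] = 0`
(`#Sel₂(E) = 1`) give `ord₂ #Ш_an(E) = 0`; `#Ш_an(Wd)` is rational (`exists_rat_shaAn_twin`); the ledger at `M₀ = 0` gives `ord₂ #Ш_an(Wd) = 0 =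
ord₂ #Ш(Wd)[2^∞]` (rank one, `#Sel₂ = 2`); `rank Wd(ℚ) = 1` and finiteness by GZK.  So on the `#Sel₂(E) = 1` cells U₂ for the cell's own twin
follows from WALL row 1 at `E` + Kolyvagin `2`-primitivity of `y_K`.  CONDITIONAL; BSD / U₂ NOT proved. [cite: Miller2011LMS, Def. 1.1]
[cite: GrossZagier1986, V §2 (2.2)] [cite: Milne1972ArithmeticAV, §1 Thm. 1] [cite: SilvermanAEC2009, Thm. X.4.2] -/
theorem bsdp_twin_of_depth_zero_of_bsdp_kOnePos (hGZ : GrossZagierAllLevels) (hGZK : MultPublishedInputsAtTwo) (hL : EntireLFunctionRat)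
    (hMi : MilneAnyModel)
    (W : WeierstrassCurve ℚ) [W.IsElliptic] [W.IsGloballyMinimal] [NeZero (W.conductorNorm ℤ)]
    (hcm : ¬ W.HasCM) (hr0 : W.analyticRank = 0) (hρ : ∀ n : ℕ, 0 < n → W.HasSurjectiveModNGaloisRep ((2 : ℤ) ^ n))
    (hT : Odd W.tamagawaProduct) (hpos : 0 < W.Δ) (hSel1 : Nat.card (W.selmerGroup 2) = 1)
    (K : Type) [Field K] [NumberField K] (hIQ : IsImaginaryQuadratic K) (hodd : Odd (NumberField.discr K))
    (h3 : NumberField.discr K ≠ -3) (hHe : SatisfiesHeegnerHypothesis (W.conductorNorm ℤ) K)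
    (hsq1 : ¬ IsSquare ((NumberField.discr K : ℚ) * -|W.Δ|)) (hsq2 : ¬ IsSquare ((NumberField.discr K : ℚ) * (-(2 * |W.Δ|))))
    (Dt : ModularParametrizationData W (W.conductorNorm ℤ))
    (hopt : ∀ z ∈ Dt.L.lattice, ∃ w ∈ periodLattice Dt.f, z = (Dt.c : ℂ) * w) (hc : Odd Dt.c)
    (β : ℤ) (ι : K →+* ℂ) (d₁ : KolyvaginHeegnerData Dt β ι 1) (hy : ¬ IsOfFinAddOrder d₁.derivedPoint)
    (M₀ : ℕ) (hdiv : ∃ Q : (W.baseChange (ringClassField K ι 1)).toAffine.Point, ((2 ^ M₀ : ℕ) : ℤ) • Q = d₁.derivedPoint)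
    (hndiv : ¬ ∃ Q : (W.baseChange (ringClassField K ι 1)).toAffine.Point, ((2 ^ (M₀ + 1) : ℕ) : ℤ) • Q = d₁.derivedPoint)
    (Wd : WeierstrassCurve ℚ) [Wd.IsElliptic] [Wd.IsGloballyMinimal]
    (hWd : ∃ C : VariableChange ℚ, C • W.quadraticTwist (NumberField.discr K : ℚ) = Wd)
    (hrd : Wd.analyticRank = 1) (hSel : Nat.card (Wd.selmerGroup 2) = 2) (hDEF : padicValNat 2 Wd.tamagawaProduct = 0)
    (hBW : BSDp W 2) (hM₀ : M₀ = 0) : BSDp Wd 2 := by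
  haveI : Fact (Nat.Prime 2) := ⟨Nat.prime_two⟩
  have hρ2 : W.HasSurjectiveModNGaloisRep 2 := by simpa using hρ 1 one_pos
  obtain ⟨-, -, qW, hqW, hvW⟩ := hBW
  have h1' : Nat.card (W.selmerGroup ((2 : ℕ) : ℤ)) = 1 := by rw [Nat.cast_ofNat]; exact hSel1
  have hW1 : Nat.card (AddCommGroup.primaryComponent (↥W.sha) 2) = 1 := by
    rw [primaryComponent_sha_eq_bot_of_natCard_selmerGroup_eq_one W 2 h1']; exact AddSubgroup.card_bot
  rw [hW1, padicValNat_one_right, Nat.cast_zero] at hvW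
  obtain ⟨qd, hqd⟩ := exists_rat_shaAn_twin hGZ hGZK hL hMi W hρ2 hT hr0 K hIQ hodd h3 hHe Dt β ι d₁ hdiv hndiv Wd hWd hrd hqW
  have hcancel := (kOnePos_depth_eq_zero_iff_defects_cancel hGZ hGZK hL hMi W hcm hr0 hρ hT hpos hSel1 K hIQ hodd h3 hHe hsq1 hsq2 Dt hopt hc β
    ι d₁ hy M₀ hdiv hndiv Wd hWd hrd hSel hDEF hqW hqd).mp hM₀
  obtain ⟨hrk, hfinD⟩ := hGZK Wd (by rw [hrd])
  haveI : Finite (↥Wd.sha) := hfinD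
  refine ⟨hrk, inferInstance, qd, hqd, ?_⟩
  rw [natCard_primaryComponent_sha_two_eq_one_of_rank_one Wd (hrk.trans hrd) hSel, padicValNat_one_right, Nat.cast_zero]
  linarith

/-! ## §3 `BSD₂(E^(d_K))` + depth zero ⟹ `BSD₂(E)` (the `closes` direction, from the ledger) -/

/-- **`BSD₂(Wd)` ∧ `M₀ = 0` ⟹ `BSD₂(E)`** at every K₁⁺ frame, modulo PRINT — the direction the route's `closes` obtains from `ShaVanishingAtDepthZeroAtTwo`
+ `ExactDescentAtTwo`, here in three lines from the ledger (`ord₂ #Ш_an(Wd) = 0` by `BSD₂(Wd)` and `Ш(Wd)[2^∞] = 0`; `M₀ = 0` ⟹ `ord₂ #Ш_an(E) = 0 =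
ord₂ #Ш(E/ℚ)[2^∞]`).  CONDITIONAL; BSD NOT proved. [cite: Miller2011LMS, Def. 1.1] [cite: GrossZagier1986, V §2 (2.2)] [cite: Milne1972ArithmeticAV, §1 Thm. 1] -/
theorem bsdp_of_depth_zero_of_bsdp_twin_kOnePos (hGZ : GrossZagierAllLevels) (hGZK : MultPublishedInputsAtTwo) (hL : EntireLFunctionRat)
    (hMi : MilneAnyModel)
    (W : WeierstrassCurve ℚ) [W.IsElliptic] [W.IsGloballyMinimal] [NeZero (W.conductorNorm ℤ)]
    (_hcm : ¬ W.HasCM) (hr0 : W.analyticRank = 0) (hρ : ∀ n : ℕ, 0 < n → W.HasSurjectiveModNGaloisRep ((2 : ℤ) ^ n))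
    (hT : Odd W.tamagawaProduct) (hpos : 0 < W.Δ) (hSel1 : Nat.card (W.selmerGroup 2) = 1)
    (K : Type) [Field K] [NumberField K] (hIQ : IsImaginaryQuadratic K) (hodd : Odd (NumberField.discr K))
    (h3 : NumberField.discr K ≠ -3) (hHe : SatisfiesHeegnerHypothesis (W.conductorNorm ℤ) K)
    (_hsq1 : ¬ IsSquare ((NumberField.discr K : ℚ) * -|W.Δ|)) (_hsq2 : ¬ IsSquare ((NumberField.discr K : ℚ) * (-(2 * |W.Δ|))))
    (Dt : ModularParametrizationData W (W.conductorNorm ℤ))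
    (_hopt : ∀ z ∈ Dt.L.lattice, ∃ w ∈ periodLattice Dt.f, z = (Dt.c : ℂ) * w) (hc : Odd Dt.c)
    (β : ℤ) (ι : K →+* ℂ) (d₁ : KolyvaginHeegnerData Dt β ι 1) (hy : ¬ IsOfFinAddOrder d₁.derivedPoint)
    (M₀ : ℕ) (hdiv : ∃ Q : (W.baseChange (ringClassField K ι 1)).toAffine.Point, ((2 ^ M₀ : ℕ) : ℤ) • Q = d₁.derivedPoint)
    (hndiv : ¬ ∃ Q : (W.baseChange (ringClassField K ι 1)).toAffine.Point, ((2 ^ (M₀ + 1) : ℕ) : ℤ) • Q = d₁.derivedPoint)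
    (Wd : WeierstrassCurve ℚ) [Wd.IsElliptic] [Wd.IsGloballyMinimal]
    (hWd : ∃ C : VariableChange ℚ, C • W.quadraticTwist (NumberField.discr K : ℚ) = Wd)
    (hrd : Wd.analyticRank = 1) (hSel : Nat.card (Wd.selmerGroup 2) = 2) (hDEF : padicValNat 2 Wd.tamagawaProduct = 0)
    (hBd : BSDp Wd 2) (hM₀ : M₀ = 0) : BSDp W 2 := by
  haveI : Fact (Nat.Prime 2) := ⟨Nat.prime_two⟩
  have hρ2 : W.HasSurjectiveModNGaloisRep 2 := by simpa using hρ 1 one_pos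
  obtain ⟨hrkd, -, qd, hqd, hvd⟩ := hBd
  rw [natCard_primaryComponent_sha_two_eq_one_of_rank_one Wd (hrkd.trans hrd) hSel, padicValNat_one_right, Nat.cast_zero] at hvd
  -- the ledger with its own rational value for `#Ш_an(E)`
  have hK1 := natCard_primaryComponent_sha_baseChange_two_eq_one_of_natCard_selmerGroup_eq_one W K hT hr0 hSel1 hIQ hodd hHe hρ2 Dt β ι
    d₁ hy M₀ hndiv Wd hWd hSel (Or.inr ⟨hpos, hDEF⟩)
  have h1' : Nat.card (W.selmerGroup ((2 : ℕ) : ℤ)) = 1 := by rw [Nat.cast_ofNat]; exact hSel1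
  have hW1 : Nat.card (AddCommGroup.primaryComponent (↥W.sha) 2) = 1 := by
    rw [primaryComponent_sha_eq_bot_of_natCard_selmerGroup_eq_one W 2 h1']; exact AddSubgroup.card_bot
  obtain ⟨qW, hqW, hledger⟩ := exists_two_mul_depth_eq_padicValRat_add hGZ hGZK hL hMi W hρ2 hT hr0 K hIQ hodd h3 hHe Dt hc β ι d₁ hdiv hndiv
    Wd hWd hrd hqd (natCard_primaryComponent_sha_two_eq_one_of_rank_one Wd (hrkd.trans hrd) hSel) (by intro _ _; rw [hK1, hW1])
  obtain ⟨hrk, hfinW⟩ := hGZK W (by rw [hr0]; exact zero_le_one)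
  haveI : Finite (↥W.sha) := hfinW
  refine ⟨hrk, inferInstance, qW, hqW, ?_⟩
  rw [hW1, padicValNat_one_right, Nat.cast_zero]
  rw [hM₀, Nat.cast_zero, mul_zero] at hledger
  linarith

/-! ## §4 `BSD₂` of the pair ⟹ depth zero -/

/-- **`BSD₂(E)` ∧ `BSD₂(Wd)` ⟹ `M₀ = 0`** at every K₁⁺ frame, modulo PRINT (= Lossless §4 `K1_of_nonCMAtTwo` with the leaf replaced by the BSD₂ PAIR):
both defects vanish, so the ledger reads `2·M₀ = 0`.  CONDITIONAL; BSD NOT proved. [cite: Miller2011LMS, Def. 1.1] [cite: GrossZagier1986, V §2 (2.2)]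
[cite: Milne1972ArithmeticAV, §1 Thm. 1] -/
theorem depth_eq_zero_of_bsdp_pair_kOnePos (hGZ : GrossZagierAllLevels) (hGZK : MultPublishedInputsAtTwo) (hL : EntireLFunctionRat)
    (hMi : MilneAnyModel)
    (W : WeierstrassCurve ℚ) [W.IsElliptic] [W.IsGloballyMinimal] [NeZero (W.conductorNorm ℤ)]
    (hcm : ¬ W.HasCM) (hr0 : W.analyticRank = 0) (hρ : ∀ n : ℕ, 0 < n → W.HasSurjectiveModNGaloisRep ((2 : ℤ) ^ n))
    (hT : Odd W.tamagawaProduct) (hpos : 0 < W.Δ) (hSel1 : Nat.card (W.selmerGroup 2) = 1)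
    (K : Type) [Field K] [NumberField K] (hIQ : IsImaginaryQuadratic K) (hodd : Odd (NumberField.discr K))
    (h3 : NumberField.discr K ≠ -3) (hHe : SatisfiesHeegnerHypothesis (W.conductorNorm ℤ) K)
    (hsq1 : ¬ IsSquare ((NumberField.discr K : ℚ) * -|W.Δ|)) (hsq2 : ¬ IsSquare ((NumberField.discr K : ℚ) * (-(2 * |W.Δ|))))
    (Dt : ModularParametrizationData W (W.conductorNorm ℤ))
    (hopt : ∀ z ∈ Dt.L.lattice, ∃ w ∈ periodLattice Dt.f, z = (Dt.c : ℂ) * w) (hc : Odd Dt.c)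
    (β : ℤ) (ι : K →+* ℂ) (d₁ : KolyvaginHeegnerData Dt β ι 1) (hy : ¬ IsOfFinAddOrder d₁.derivedPoint)
    (M₀ : ℕ) (hdiv : ∃ Q : (W.baseChange (ringClassField K ι 1)).toAffine.Point, ((2 ^ M₀ : ℕ) : ℤ) • Q = d₁.derivedPoint)
    (hndiv : ¬ ∃ Q : (W.baseChange (ringClassField K ι 1)).toAffine.Point, ((2 ^ (M₀ + 1) : ℕ) : ℤ) • Q = d₁.derivedPoint)
    (Wd : WeierstrassCurve ℚ) [Wd.IsElliptic] [Wd.IsGloballyMinimal]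
    (hWd : ∃ C : VariableChange ℚ, C • W.quadraticTwist (NumberField.discr K : ℚ) = Wd)
    (hrd : Wd.analyticRank = 1) (hSel : Nat.card (Wd.selmerGroup 2) = 2) (hDEF : padicValNat 2 Wd.tamagawaProduct = 0)
    (hBW : BSDp W 2) (hBd : BSDp Wd 2) : M₀ = 0 := by
  haveI : Fact (Nat.Prime 2) := ⟨Nat.prime_two⟩
  obtain ⟨-, -, qW, hqW, hvW⟩ := hBW
  obtain ⟨hrkd, -, qd, hqd, hvd⟩ := hBd
  have h1' : Nat.card (W.selmerGroup ((2 : ℕ) : ℤ)) = 1 := by rw [Nat.cast_ofNat]; exact hSel1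
  have hW1 : Nat.card (AddCommGroup.primaryComponent (↥W.sha) 2) = 1 := by
    rw [primaryComponent_sha_eq_bot_of_natCard_selmerGroup_eq_one W 2 h1']; exact AddSubgroup.card_bot
  rw [hW1, padicValNat_one_right, Nat.cast_zero] at hvW
  rw [natCard_primaryComponent_sha_two_eq_one_of_rank_one Wd (hrkd.trans hrd) hSel, padicValNat_one_right, Nat.cast_zero] at hvd
  exact (kOnePos_depth_eq_zero_iff_defects_cancel hGZ hGZK hL hMi W hcm hr0 hρ hT hpos hSel1 K hIQ hodd h3 hHe hsq1 hsq2 Dt hopt hc β ι d₁ hy M₀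
    hdiv hndiv Wd hWd hrd hSel hDEF hqW hqd).mpr (by rw [hvW, hvd, add_zero])

end Summit.BirchSwinnertonDyer.BirchSwinnertonDyer.Theorems.GenusExact.ValuationLedger

end
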